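import Summits.RiemannHypothesis.RiemannHypothesis.Theses.SparseScrewLandau
import HarnessLib

/-!
# `SparseScrewLandau.Assembly` (item stmt-RiemannHypothesis-23407) — glue closer

`QuarticSampleLandau` is `QuarticSampleFloor → RiemannHypothesis`; applying it to `QuarticSampleFloor` gives
`Summit.RiemannHypothesis` (which unfolds to `RiemannHypothesis`).
Cell rh-split (typer-3 g3 glue sweep, RULING #374).  Pure propositional glue; no analysis.
Nothing here bears on the truth of RH.
-/

set_option linter.dupNamespace false  -- the mandated namespace repeats `RiemannHypothesis`

namespace Summit.RiemannHypothesis.RiemannHypothesis.Theorems.SparseScrewLandau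

/-- **`Assembly` (item stmt-RiemannHypothesis-23407) holds**: modus ponens. [folklore] -/
theorem assembly_proof : Summit.RiemannHypothesis.RiemannHypothesis.Theses.SparseScrewLandau.Assembly :=
  fun h1 h2 => h1 h2

end Summit.RiemannHypothesis.RiemannHypothesis.Theorems.SparseScrewLandau
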